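import Summits.AtomisticToContinuum.Crystallization.Theorems.FrustratedLawDichotomyStrainedPatchTaylorRegular
import Summits.AtomisticToContinuum.Crystallization.Theorems.FrustratedLawDichotomyFarFieldSharp

/-!
# Band-certificate KIT for the record potential `W₄₅`: regime formulas for `W₄₅′`, `W₄₅″` and generic interval lemmas (lens-5 g53, crux 27623 T-side)

Tools for leaf (N) `…TaylorLeaves.KbandCert` of node (T2-bent₁).  §1: the first and second derivatives of `Wrec = W₄₅` on the four regimes as
closed forms — bump `(0, 8/5)`: `W′ = V′ − (3/160)·ω₂′(5s/4)`, `W″ = V″ − (3/128)·ω₂″(5s/4)` (`ljD1`, `ljD2`, `dOmega`, `ddOmega`); pure LJ `(8/5, 3)`;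
window `(3, 9/2)`: `W′ = V′p + Vp′`, `W″ = V″p + 2V′p′ + Vp″` with `p = 1 − w₄₅ = (16s³ − 180s² + 648s − 729)/27` (`pW`, `pW1`, `pW2`); far: `0`
(`deriv2_Wrec_{bump,lj,window,far}` via `Filter.EventuallyEq.deriv_eq` from the tree's closed-regime formulas).  §2: interval toolkit — inverse-power
monotonicity, a triangle bound for quintics, the factorizations `ω₂′ = (u − 2)⁵R₁`, `ω₂″ = (u − 2)⁴R₂` with the envelopes `|ω₂′(u)| ≤ (2 − l)⁵S₁(U)`,
`|ω₂″(u)| ≤ (2 − l)⁴S₂(U)` on `l ≤ u ≤ U ≤ 2`, and signed product bounds.  §3: GENERIC BAND LEMMAS `bump_band`, `lj_band`, `window_band_lo/hi`,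
`far_band : (numeric hypothesis on lo, hi, K) → BandOK lo hi K`, where `BandOK lo hi K := ∀ s ∈ [lo, hi] ∖ junctions, |W″ s| ≤ K ∧ |W′ s| ≤ K·s`; each
numeric hypothesis is a closed rational inequality in `lo, hi, K` (decoupled monotone envelopes; in the window the signs `V ≤ 0 ≤ V′`, `V″ ≤ 0`,
`0 ≤ p`, `p′ ≤ 0`, `sign p″ = sign(s − 15/4)` are used), so every sub-band instance in `…TaylorKband` is ONE `norm_num` call.
-/

open scoped BigOperators Classical
open Summit.AtomisticToContinuum.Crystallization.Theorems.FrustratedLawDichotomyRangeCut (Sep)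
open Summit.AtomisticToContinuum.Crystallization.Theorems.FrustratedLawDichotomyMotifLemmas
open Summit.AtomisticToContinuum.Crystallization.Theorems.FrustratedLawDichotomyAveragingCut
open Summit.AtomisticToContinuum.Crystallization.Theorems.FrustratedLawDichotomyAveragingRuleCap
open Summit.AtomisticToContinuum.Crystallization.Theorems.FrustratedLawDichotomyAveragingRuleTightFree
open Summit.AtomisticToContinuum.Crystallization.Theorems.FrustratedLawDichotomyExemptAbsorptionRecord
open Summit.AtomisticToContinuum.Crystallization.Theorems.FrustratedLawDichotomySchurCut
open Literature.MathematicalPhysics.StatisticalMechanics (lennardJones lennardJones_nonpos)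
open Summit.AtomisticToContinuum.Crystallization.Theorems.FrustratedLawDichotomyRuleToolkitGood
open Summit.AtomisticToContinuum.Crystallization.Theorems.FrustratedLawDichotomyStrainedPatchHomSplit
open Summit.AtomisticToContinuum.Crystallization.Theorems.FrustratedLawDichotomyStrainedPatchHomTermCalculus
open Summit.AtomisticToContinuum.Crystallization.Theorems.FrustratedLawDichotomyStrainedPatchChartFamilies
open Summit.AtomisticToContinuum.Crystallization.Theorems.FrustratedLawDichotomyStrainedPatchChartFamiliesBent
open Summit.AtomisticToContinuum.Crystallization.Theorems.FrustratedLawDichotomyStrainedPatchChartFamiliesPinned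
open Summit.AtomisticToContinuum.Crystallization.Theorems.FrustratedLawDichotomyStrainedPatchEnvelopeLaw
open Summit.AtomisticToContinuum.Crystallization.Theorems.FrustratedLawDichotomyStrainedPatchEnvelopeTaylor

open Summit.AtomisticToContinuum.Crystallization.Theorems.FrustratedLawDichotomyStrainedPatchTaylorSplit
open Summit.AtomisticToContinuum.Crystallization.Theorems.FrustratedLawDichotomyStrainedPatchTaylorPair
open Summit.AtomisticToContinuum.Crystallization.Theorems.FrustratedLawDichotomyStrainedPatchTaylorChord

open Summit.AtomisticToContinuum.Crystallization.Theorems.FrustratedLawDichotomyStrainedPatchTaylorLeaves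

open Summit.AtomisticToContinuum.Crystallization.Theorems.FrustratedLawDichotomyStrainedPatchTaylorLeaves
open Summit.AtomisticToContinuum.Crystallization.Theorems.FrustratedLawDichotomyStrainedPatchTaylorRegular

namespace Summit.AtomisticToContinuum.Crystallization.Theorems.FrustratedLawDichotomyStrainedPatchTaylorKbandKit

open Summit.AtomisticToContinuum.Crystallization.Theorems.FrustratedLawDichotomyFarFieldSharp (inv_pow_le_inv_pow_of_le)

/-! ## §1. Regime formulas for `W₄₅′` and `W₄₅″` -/

/-- `V′` as a function. -/
noncomputable def ljD1 (s : ℝ) : ℝ := -(s⁻¹) ^ 13 + (s⁻¹) ^ 7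
/-- `V″` as a function. -/
noncomputable def ljD2 (s : ℝ) : ℝ := 13 * (s⁻¹) ^ 14 - 7 * (s⁻¹) ^ 8
/-- The second derivative polynomial `ω₂″`. -/
noncomputable def ddOmega (u : ℝ) : ℝ :=
  -(11 / 3) + 99 / 4 * u ^ 2 - 385 / 16 * u ^ 3 + 693 / 128 * u ^ 5 - 99 / 128 * u ^ 7 + 275 / 6144 * u ^ 9
/-- The window factor `1 − w₄₅` and its two derivatives on `[3, 9/2]`. -/
noncomputable def pW (s : ℝ) : ℝ := (16 * s ^ 3 - 180 * s ^ 2 + 648 * s - 729) / 27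
/-- `p′ = (16s² − 120s + 216)/9`. -/
noncomputable def pW1 (s : ℝ) : ℝ := (16 * s ^ 2 - 120 * s + 216) / 9
/-- `p″ = (32s − 120)/9`. -/
noncomputable def pW2 (s : ℝ) : ℝ := (32 * s - 120) / 9

/-- `V′ = ljD1` off `0`. [formal bookkeeping] -/
theorem hasDerivAt_lj {s : ℝ} (hs : s ≠ 0) : HasDerivAt lennardJones (ljD1 s) s := by
  have h1 : HasDerivAt (fun y : ℝ => y⁻¹) (-(s ^ 2)⁻¹) s := hasDerivAt_inv hs
  rw [lennardJones_eq]
  refine (((h1.pow 12).const_mul (1 / 12 : ℝ)).sub ((h1.pow 6).const_mul (1 / 6 : ℝ))).congr_deriv ?_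
  rw [ljD1]; push_cast; field_simp; ring

/-- `V″ = ljD2` off `0` (the tree's `hasDerivAt_deriv_lennardJones`). [formal bookkeeping] -/
theorem hasDerivAt_ljD1 {s : ℝ} (hs : s ≠ 0) : HasDerivAt ljD1 (ljD2 s) s := hasDerivAt_deriv_lennardJones hs

/-- `ω₂′′ = ddOmega`. [formal bookkeeping] -/
theorem hasDerivAt_dOmega (u : ℝ) : HasDerivAt dOmega (ddOmega u) u := by
  have h := hasDerivAt_id' u
  have e : dOmega = fun u : ℝ => -(11 / 3) * u + 33 / 4 * u ^ 3 - 385 / 64 * u ^ 4 + 231 / 256 * u ^ 6 - 99 / 1024 * u ^ 8 +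
      55 / 12288 * u ^ 10 := by funext u; rfl
  rw [e]
  refine ((((((h.const_mul (-(11 / 3) : ℝ)).add ((h.pow 3).const_mul (33 / 4 : ℝ))).sub ((h.pow 4).const_mul (385 / 64 : ℝ))).add
    ((h.pow 6).const_mul (231 / 256 : ℝ))).sub ((h.pow 8).const_mul (99 / 1024 : ℝ))).add ((h.pow 10).const_mul (55 / 12288 : ℝ))).congr_deriv ?_
  rw [ddOmega]; norm_num; ring

/-- `p′ = pW1`. [formal bookkeeping] -/
theorem hasDerivAt_pW (s : ℝ) : HasDerivAt pW (pW1 s) s := by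
  have h := hasDerivAt_id' s
  have e : pW = fun s : ℝ => (16 * s ^ 3 - 180 * s ^ 2 + 648 * s - 729) / 27 := by funext s; rfl
  rw [e]
  refine (((((h.pow 3).const_mul (16 : ℝ)).sub ((h.pow 2).const_mul (180 : ℝ))).add (h.const_mul (648 : ℝ))).sub_const (729 : ℝ)
    |>.div_const 27).congr_deriv ?_
  rw [pW1]; norm_num; ring

/-- `p″ = pW2`. [formal bookkeeping] -/
theorem hasDerivAt_pW1 (s : ℝ) : HasDerivAt pW1 (pW2 s) s := by
  have h := hasDerivAt_id' s
  have e : pW1 = fun s : ℝ => (16 * s ^ 2 - 120 * s + 216) / 9 := by funext s; rfl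
  rw [e]
  refine (((((h.pow 2).const_mul (16 : ℝ)).sub (h.const_mul (120 : ℝ))).add_const (216 : ℝ)).div_const 9).congr_deriv ?_
  rw [pW2]; norm_num; ring

/-- Bump regime, first derivative (closed regime `0 < s ≤ 8/5`). [formal bookkeeping] -/
theorem deriv_Wrec_bump {s : ℝ} (h0 : 0 < s) (h : s ≤ 8 / 5) : deriv Wrec s = ljD1 s - 3 / 160 * dOmega (5 * s / 4) := by
  rw [show deriv Wrec s = _ from deriv_effPot45_bump h0 h, ljD1, dOmega]

/-- Pure-LJ regime, first derivative (closed). [formal bookkeeping] -/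
theorem deriv_Wrec_lj {s : ℝ} (h1 : 8 / 5 ≤ s) (h2 : s ≤ 3) : deriv Wrec s = ljD1 s := deriv_effPot45_lj h1 h2

/-- Window regime, first derivative (closed). [formal bookkeeping] -/
theorem deriv_Wrec_window {s : ℝ} (h1 : 3 ≤ s) (h2 : s ≤ 9 / 2) : deriv Wrec s = ljD1 s * pW s + lennardJones s * pW1 s :=
  deriv_effPot45_window h1 h2

/-- Far regime, first derivative. [formal bookkeeping] -/
theorem deriv_Wrec_far {s : ℝ} (h : 9 / 2 ≤ s) : deriv Wrec s = 0 := deriv_effPot45_far h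

/-- ★ Bump regime, SECOND derivative on the open regime `0 < s < 8/5`. [folklore] -/
theorem deriv2_Wrec_bump {s : ℝ} (h0 : 0 < s) (h : s < 8 / 5) : deriv (deriv Wrec) s = ljD2 s - 3 / 128 * ddOmega (5 * s / 4) := by
  have heq : deriv Wrec =ᶠ[nhds s] fun y => ljD1 y - 3 / 160 * dOmega (5 * y / 4) := by
    filter_upwards [Ioo_mem_nhds h0 h] with y hy using deriv_Wrec_bump hy.1 hy.2.le
  rw [heq.deriv_eq]
  have hu : HasDerivAt (fun y : ℝ => 5 * y / 4) (5 / 4) s := by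
    simpa using ((hasDerivAt_id s).const_mul (5:ℝ)).div_const (4:ℝ)
  have hd : HasDerivAt (fun y => ljD1 y - 3 / 160 * dOmega (5 * y / 4)) (ljD2 s - 3 / 160 * (ddOmega (5 * s / 4) * (5 / 4))) s :=
    (hasDerivAt_ljD1 h0.ne').sub (((hasDerivAt_dOmega (5 * s / 4)).comp s hu).const_mul (3 / 160))
  rw [hd.deriv]; ring

/-- ★ Pure-LJ regime, second derivative on `(8/5, 3)`. [folklore] -/
theorem deriv2_Wrec_lj {s : ℝ} (h1 : 8 / 5 < s) (h2 : s < 3) : deriv (deriv Wrec) s = ljD2 s := by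
  have heq : deriv Wrec =ᶠ[nhds s] ljD1 := by
    filter_upwards [Ioo_mem_nhds h1 h2] with y hy using deriv_Wrec_lj hy.1.le hy.2.le
  rw [heq.deriv_eq]
  exact (hasDerivAt_ljD1 (by linarith : s ≠ 0)).deriv

/-- ★ Window regime, second derivative on `(3, 9/2)`: `V″p + 2V′p′ + Vp″`. [folklore] -/
theorem deriv2_Wrec_window {s : ℝ} (h1 : 3 < s) (h2 : s < 9 / 2) :
    deriv (deriv Wrec) s = ljD2 s * pW s + 2 * (ljD1 s * pW1 s) + lennardJones s * pW2 s := by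
  have heq : deriv Wrec =ᶠ[nhds s] fun y => ljD1 y * pW y + lennardJones y * pW1 y := by
    filter_upwards [Ioo_mem_nhds h1 h2] with y hy using deriv_Wrec_window hy.1.le hy.2.le
  rw [heq.deriv_eq]
  have hs : s ≠ 0 := by linarith
  have hd : HasDerivAt (fun y => ljD1 y * pW y + lennardJones y * pW1 y)
      (ljD2 s * pW s + ljD1 s * pW1 s + (ljD1 s * pW1 s + lennardJones s * pW2 s)) s :=
    ((hasDerivAt_ljD1 hs).mul (hasDerivAt_pW s)).add ((hasDerivAt_lj hs).mul (hasDerivAt_pW1 s))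
  rw [hd.deriv]; ring

/-- Far regime, second derivative on `(9/2, ∞)`. [formal bookkeeping] -/
theorem deriv2_Wrec_far {s : ℝ} (h : 9 / 2 < s) : deriv (deriv Wrec) s = 0 := by
  have heq : deriv Wrec =ᶠ[nhds s] fun _ => (0:ℝ) := by
    filter_upwards [Ioi_mem_nhds h] with y hy using deriv_Wrec_far hy.le
  rw [heq.deriv_eq, deriv_const]

/-! ## §2. Interval toolkit -/

-- `inv_pow_le` is already landed as `…FrustratedLawDichotomyFarFieldSharp.inv_pow_le_inv_pow_of_le` (gate dedup) and is used from there.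

/-- Triangle bound for a quintic with `0 ≤ u ≤ U`. -/
theorem abs_poly5_le {u U : ℝ} (h0 : 0 ≤ u) (hU : u ≤ U) (a0 a1 a2 a3 a4 a5 : ℝ) :
    |a0 + a1 * u + a2 * u ^ 2 + a3 * u ^ 3 + a4 * u ^ 4 + a5 * u ^ 5| ≤
      |a0| + |a1| * U + |a2| * U ^ 2 + |a3| * U ^ 3 + |a4| * U ^ 4 + |a5| * U ^ 5 := by
  have hk : ∀ (a : ℝ) (n : ℕ), |a * u ^ n| ≤ |a| * U ^ n := fun a n => by
    rw [abs_mul, abs_of_nonneg (pow_nonneg h0 n)]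
    exact mul_le_mul_of_nonneg_left (pow_le_pow_left₀ h0 hU n) (abs_nonneg a)
  have h1 : |a1 * u| ≤ |a1| * U := by
    rw [abs_mul, abs_of_nonneg h0]; exact mul_le_mul_of_nonneg_left hU (abs_nonneg a1)
  have e0 := le_abs_self a0; have e0' := neg_abs_le a0
  obtain ⟨l1, u1⟩ := abs_le.1 h1
  obtain ⟨l2, u2⟩ := abs_le.1 (hk a2 2); obtain ⟨l3, u3⟩ := abs_le.1 (hk a3 3)
  obtain ⟨l4, u4⟩ := abs_le.1 (hk a4 4); obtain ⟨l5, u5⟩ := abs_le.1 (hk a5 5)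
  rw [abs_le]; constructor <;> linarith

/-- Absolute coefficient sums of the cofactors of `ω₂′ = (u−2)⁵·R₁` and `ω₂″ = (u−2)⁴·R₂`. -/
noncomputable def S1 (U : ℝ) : ℝ := 11 / 96 * U + 55 / 192 * U ^ 2 + 11 / 64 * U ^ 3 + 275 / 6144 * U ^ 4 + 55 / 12288 * U ^ 5
/-- `S₂`: absolute coefficient sum of `R₂`. -/
noncomputable def S2 (U : ℝ) : ℝ :=
  11 / 48 + 11 / 24 * U + 187 / 192 * U ^ 2 + 781 / 768 * U ^ 3 + 275 / 768 * U ^ 4 + 275 / 6144 * U ^ 5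

/-- `ω₂′(u) = (u − 2)⁵ · R₁(u)`. [formal bookkeeping] -/
theorem dOmega_eq (u : ℝ) :
    dOmega u = (u - 2) ^ 5 * (0 + 11 / 96 * u + 55 / 192 * u ^ 2 + 11 / 64 * u ^ 3 + 275 / 6144 * u ^ 4 + 55 / 12288 * u ^ 5) := by
  rw [dOmega]; ring

/-- `ω₂″(u) = (u − 2)⁴ · R₂(u)`. [formal bookkeeping] -/
theorem ddOmega_eq (u : ℝ) :
    ddOmega u = (u - 2) ^ 4 * (-(11 / 48) + -(11 / 24) * u + 187 / 192 * u ^ 2 + 781 / 768 * u ^ 3 + 275 / 768 * u ^ 4 +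
      275 / 6144 * u ^ 5) := by
  rw [ddOmega]; ring

/-- ★ Envelope `|ω₂′(u)| ≤ (2 − l)⁵ S₁(U)` for `0 ≤ l ≤ u ≤ U ≤ 2`. [folklore] -/
theorem abs_dOmega_le {u l U : ℝ} (h0 : 0 ≤ u) (hU : u ≤ U) (hl : l ≤ u) (h2 : U ≤ 2) : |dOmega u| ≤ (2 - l) ^ 5 * S1 U := by
  rw [dOmega_eq, abs_mul, show (u - 2) ^ 5 = -((2 - u) ^ 5) by ring, abs_neg, abs_of_nonneg (pow_nonneg (by linarith) 5)]
  refine mul_le_mul (pow_le_pow_left₀ (by linarith) (by linarith) 5) ?_ (abs_nonneg _) (pow_nonneg (by linarith) 5)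
  refine (abs_poly5_le h0 hU _ _ _ _ _ _).trans (le_of_eq ?_)
  rw [S1]; norm_num

/-- ★ Envelope `|ω₂″(u)| ≤ (2 − l)⁴ S₂(U)` for `0 ≤ l ≤ u ≤ U ≤ 2`. [folklore] -/
theorem abs_ddOmega_le {u l U : ℝ} (h0 : 0 ≤ u) (hU : u ≤ U) (hl : l ≤ u) (h2 : U ≤ 2) : |ddOmega u| ≤ (2 - l) ^ 4 * S2 U := by
  rw [ddOmega_eq, abs_mul, show (u - 2) ^ 4 = (2 - u) ^ 4 by ring, abs_of_nonneg (pow_nonneg (by linarith) 4)]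
  refine mul_le_mul (pow_le_pow_left₀ (by linarith) (by linarith) 4) ?_ (abs_nonneg _) (pow_nonneg (by linarith) 4)
  refine (abs_poly5_le h0 hU _ _ _ _ _ _).trans (le_of_eq ?_)
  rw [S2]; norm_num

/-- Product lower bound: `x ∈ [X, 0]` (with `X ≤ 0`), `y ∈ [0, Y]` ⟹ `X·Y ≤ x·y`. -/
theorem prod_lower_np {x y X Y : ℝ} (hx : X ≤ x) (hX : X ≤ 0) (hy0 : 0 ≤ y) (hy : y ≤ Y) : X * Y ≤ x * y := by
  have h1 : X * y ≤ x * y := mul_le_mul_of_nonneg_right hx hy0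
  have h2 : X * Y ≤ X * y := mul_le_mul_of_nonpos_left hy hX
  linarith

/-- Product lower bound: `x ∈ [0, X]`, `y ∈ [Y, 0]` ⟹ `X·Y ≤ x·y`. -/
theorem prod_lower_pn {x y X Y : ℝ} (hx0 : 0 ≤ x) (hx : x ≤ X) (hY : Y ≤ y) (hy0 : y ≤ 0) : X * Y ≤ x * y := by
  have h1 : X * y ≤ x * y := mul_le_mul_of_nonpos_right hx hy0
  have h2 : X * Y ≤ X * y := mul_le_mul_of_nonneg_left hY (hx0.trans hx)
  linarith

/-- Product upper bound: `x ∈ [X, 0]` (with `X ≤ 0`), `y ∈ [Y, 0]` ⟹ `x·y ≤ X·Y`. -/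
theorem prod_upper_nn {x y X Y : ℝ} (hx : X ≤ x) (hX : X ≤ 0) (hY : Y ≤ y) (hy0 : y ≤ 0) : x * y ≤ X * Y := by
  have h1 : x * y ≤ X * y := mul_le_mul_of_nonpos_right hx hy0
  have h2 : X * y ≤ X * Y := mul_le_mul_of_nonpos_left hY hX
  linarith

/-! ## §3. Generic band lemmas -/

/-- The certificate content on one sub-band. -/
def BandOK (lo hi K : ℝ) : Prop :=
  ∀ s : ℝ, lo ≤ s → s ≤ hi → s ∉ junctions → |deriv (deriv Wrec) s| ≤ K ∧ |deriv Wrec s| ≤ K * s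

/-- Adjacent sub-bands glue. [formal bookkeeping] -/
theorem BandOK.union {a b c K : ℝ} (h1 : BandOK a b K) (h2 : BandOK b c K) : BandOK a c K := by
  intro s ha hc hJ
  rcases le_or_gt s b with h | h
  · exact h1 s ha h hJ
  · exact h2 s h.le hc hJ

/-- Membership in the junction set. [formal bookkeeping] -/
theorem mem_junctions {s : ℝ} : s ∈ junctions ↔ s = 8 / 5 ∨ s = 3 ∨ s = 9 / 2 := by simp [junctions]

/-- ★ BUMP-regime band lemma (`0 < lo ≤ s ≤ hi ≤ 8/5`). -/
theorem bump_band {lo hi K : ℝ}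
    (h : 0 < lo ∧ lo ≤ hi ∧ hi ≤ 8 / 5 ∧ 0 ≤ K ∧
      13 * lo⁻¹ ^ 14 - 7 * hi⁻¹ ^ 8 + 3 / 128 * ((2 - 5 * lo / 4) ^ 4 * S2 (5 * hi / 4)) ≤ K ∧
      7 * lo⁻¹ ^ 8 - 13 * hi⁻¹ ^ 14 + 3 / 128 * ((2 - 5 * lo / 4) ^ 4 * S2 (5 * hi / 4)) ≤ K ∧
      lo⁻¹ ^ 7 - hi⁻¹ ^ 13 + 3 / 160 * ((2 - 5 * lo / 4) ^ 5 * S1 (5 * hi / 4)) ≤ K * lo ∧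
      lo⁻¹ ^ 13 - hi⁻¹ ^ 7 + 3 / 160 * ((2 - 5 * lo / 4) ^ 5 * S1 (5 * hi / 4)) ≤ K * lo) : BandOK lo hi K := by
  obtain ⟨hlo, _, hhi, hK, c1, c2, c3, c4⟩ := h
  intro s hls hsh hJ
  have hs0 : 0 < s := hlo.trans_le hls
  have hs85 : s < 8 / 5 := lt_of_le_of_ne (hsh.trans hhi) (fun e => hJ (mem_junctions.2 (Or.inl e)))
  have i14 := inv_pow_le_inv_pow_of_le hlo hls 14; have j14 := inv_pow_le_inv_pow_of_le hs0 hsh 14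
  have i8 := inv_pow_le_inv_pow_of_le hlo hls 8; have j8 := inv_pow_le_inv_pow_of_le hs0 hsh 8
  have i7 := inv_pow_le_inv_pow_of_le hlo hls 7; have j7 := inv_pow_le_inv_pow_of_le hs0 hsh 7
  have i13 := inv_pow_le_inv_pow_of_le hlo hls 13; have j13 := inv_pow_le_inv_pow_of_le hs0 hsh 13
  have b2 := abs_ddOmega_le (u := 5 * s / 4) (l := 5 * lo / 4) (U := 5 * hi / 4) (by linarith) (by linarith) (by linarith) (by linarith)
  have b1 := abs_dOmega_le (u := 5 * s / 4) (l := 5 * lo / 4) (U := 5 * hi / 4) (by linarith) (by linarith) (by linarith) (by linarith)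
  obtain ⟨b2l, b2u⟩ := abs_le.1 b2
  obtain ⟨b1l, b1u⟩ := abs_le.1 b1
  have hKs : K * lo ≤ K * s := mul_le_mul_of_nonneg_left hls hK
  rw [deriv2_Wrec_bump hs0 hs85, deriv_Wrec_bump hs0 hs85.le, ljD2, ljD1]
  constructor <;> (rw [abs_le]; constructor <;> linarith)

/-- ★ PURE-LJ-regime band lemma (`8/5 ≤ lo ≤ s ≤ hi ≤ 3`). -/
theorem lj_band {lo hi K : ℝ}
    (h : 8 / 5 ≤ lo ∧ lo ≤ hi ∧ hi ≤ 3 ∧ 0 ≤ K ∧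
      13 * lo⁻¹ ^ 14 - 7 * hi⁻¹ ^ 8 ≤ K ∧ 7 * lo⁻¹ ^ 8 - 13 * hi⁻¹ ^ 14 ≤ K ∧
      lo⁻¹ ^ 7 - hi⁻¹ ^ 13 ≤ K * lo ∧ lo⁻¹ ^ 13 - hi⁻¹ ^ 7 ≤ K * lo) : BandOK lo hi K := by
  obtain ⟨hlo, _, hhi, hK, c1, c2, c3, c4⟩ := h
  intro s hls hsh hJ
  have hl0 : 0 < lo := by linarith
  have hs0 : 0 < s := hl0.trans_le hls
  have hs1 : 8 / 5 < s := lt_of_le_of_ne (hlo.trans hls) (fun e => hJ (mem_junctions.2 (Or.inl e.symm)))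
  have hs2 : s < 3 := lt_of_le_of_ne (hsh.trans hhi) (fun e => hJ (mem_junctions.2 (Or.inr (Or.inl e))))
  have i14 := inv_pow_le_inv_pow_of_le hl0 hls 14; have j14 := inv_pow_le_inv_pow_of_le hs0 hsh 14
  have i8 := inv_pow_le_inv_pow_of_le hl0 hls 8; have j8 := inv_pow_le_inv_pow_of_le hs0 hsh 8
  have i7 := inv_pow_le_inv_pow_of_le hl0 hls 7; have j7 := inv_pow_le_inv_pow_of_le hs0 hsh 7
  have i13 := inv_pow_le_inv_pow_of_le hl0 hls 13; have j13 := inv_pow_le_inv_pow_of_le hs0 hsh 13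
  have hKs : K * lo ≤ K * s := mul_le_mul_of_nonneg_left hls hK
  rw [deriv2_Wrec_lj hs1 hs2, deriv_Wrec_lj hs1.le hs2.le, ljD2, ljD1]
  constructor <;> (rw [abs_le]; constructor <;> linarith)

/-- Sign and size facts in the window regime `3 ≤ s`. -/
theorem window_facts {lo hi s : ℝ} (h3 : 3 ≤ lo) (hls : lo ≤ s) (hsh : s ≤ hi) (hhi : hi ≤ 9 / 2) :
    (1 / 12 * hi⁻¹ ^ 12 - 1 / 6 * lo⁻¹ ^ 6 ≤ lennardJones s ∧ lennardJones s ≤ 0) ∧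
    (0 ≤ ljD1 s ∧ ljD1 s ≤ lo⁻¹ ^ 7 - hi⁻¹ ^ 13) ∧
    (13 * hi⁻¹ ^ 14 - 7 * lo⁻¹ ^ 8 ≤ ljD2 s ∧ ljD2 s ≤ 0) ∧
    (0 ≤ pW s ∧ pW s ≤ 16 / 27 * (9 / 2 - lo) ^ 2 * (hi - 9 / 4)) ∧
    (-(16 / 9 * (9 / 2 - lo) * (hi - 3)) ≤ pW1 s ∧ pW1 s ≤ 0) ∧
    ((32 * lo - 120) / 9 ≤ pW2 s ∧ pW2 s ≤ (32 * hi - 120) / 9) := by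
  have hl0 : 0 < lo := by linarith
  have hs0 : 0 < s := by linarith
  have ht0 : 0 ≤ s⁻¹ := inv_nonneg.2 hs0.le
  have ht3 : s⁻¹ ≤ 3⁻¹ := inv_anti₀ (by norm_num) (h3.trans hls)
  have ht6 : s⁻¹ ^ 6 ≤ 3⁻¹ ^ 6 := pow_le_pow_left₀ ht0 ht3 6
  have i12 := inv_pow_le_inv_pow_of_le hs0 hsh 12; have i6 := inv_pow_le_inv_pow_of_le hl0 hls 6
  have i14 := inv_pow_le_inv_pow_of_le hs0 hsh 14; have i8 := inv_pow_le_inv_pow_of_le hl0 hls 8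
  have i7 := inv_pow_le_inv_pow_of_le hl0 hls 7; have i13 := inv_pow_le_inv_pow_of_le hs0 hsh 13
  have p6 := pow_nonneg ht0 6; have p7 := pow_nonneg ht0 7; have p8 := pow_nonneg ht0 8
  have hLJ : lennardJones s = 1 / 12 * s⁻¹ ^ 12 - 1 / 6 * s⁻¹ ^ 6 := by rw [lennardJones_eq]
  refine ⟨⟨by rw [hLJ]; linarith, ?_⟩, ⟨?_, by rw [ljD1]; linarith⟩, ⟨by rw [ljD2]; linarith, ?_⟩, ⟨?_, ?_⟩, ⟨?_, ?_⟩, ⟨?_, ?_⟩⟩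
  · rw [hLJ]
    have : s⁻¹ ^ 12 = s⁻¹ ^ 6 * s⁻¹ ^ 6 := by ring
    nlinarith [mul_le_mul_of_nonneg_left ht6 p6]
  · rw [ljD1]
    have : s⁻¹ ^ 13 = s⁻¹ ^ 7 * s⁻¹ ^ 6 := by ring
    nlinarith [mul_le_mul_of_nonneg_left ht6 p7]
  · rw [ljD2]
    have : s⁻¹ ^ 14 = s⁻¹ ^ 8 * s⁻¹ ^ 6 := by ring
    nlinarith [mul_le_mul_of_nonneg_left ht6 p8]
  · rw [show pW s = 16 / 27 * (9 / 2 - s) ^ 2 * (s - 9 / 4) by rw [pW]; ring]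
    exact mul_nonneg (mul_nonneg (by norm_num) (sq_nonneg _)) (by linarith)
  · rw [show pW s = 16 / 27 * (9 / 2 - s) ^ 2 * (s - 9 / 4) by rw [pW]; ring, mul_assoc, mul_assoc]
    refine mul_le_mul_of_nonneg_left ?_ (by norm_num)
    exact mul_le_mul (pow_le_pow_left₀ (by linarith) (by linarith) 2) (by linarith) (by linarith) (sq_nonneg _)
  · rw [show pW1 s = -(16 / 9 * (9 / 2 - s) * (s - 3)) by rw [pW1]; ring, neg_le_neg_iff, mul_assoc, mul_assoc]
    refine mul_le_mul_of_nonneg_left ?_ (by norm_num)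
    exact mul_le_mul (by linarith) (by linarith) (by linarith) (by linarith)
  · rw [show pW1 s = -(16 / 9 * (9 / 2 - s) * (s - 3)) by rw [pW1]; ring, neg_nonpos]
    exact mul_nonneg (mul_nonneg (by norm_num) (by linarith)) (by linarith)
  · rw [pW2]; linarith
  · rw [pW2]; linarith

/-- ★ WINDOW-regime band lemma, lower half (`3 ≤ lo ≤ s ≤ hi ≤ 15/4`, where `(1 − w₄₅)″ ≤ 0`). -/
theorem window_band_lo {lo hi K : ℝ}
    (h : 3 ≤ lo ∧ lo ≤ hi ∧ hi ≤ 15 / 4 ∧ 0 ≤ K ∧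
      13 * hi⁻¹ ^ 14 - 7 * lo⁻¹ ^ 8 ≤ 0 ∧ 1 / 12 * hi⁻¹ ^ 12 - 1 / 6 * lo⁻¹ ^ 6 ≤ 0 ∧
      (1 / 12 * hi⁻¹ ^ 12 - 1 / 6 * lo⁻¹ ^ 6) * ((32 * lo - 120) / 9) ≤ K ∧
      -((13 * hi⁻¹ ^ 14 - 7 * lo⁻¹ ^ 8) * (16 / 27 * (9 / 2 - lo) ^ 2 * (hi - 9 / 4)) +
        2 * ((lo⁻¹ ^ 7 - hi⁻¹ ^ 13) * -(16 / 9 * (9 / 2 - lo) * (hi - 3)))) ≤ K ∧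
      (lo⁻¹ ^ 7 - hi⁻¹ ^ 13) * (16 / 27 * (9 / 2 - lo) ^ 2 * (hi - 9 / 4)) +
        (1 / 12 * hi⁻¹ ^ 12 - 1 / 6 * lo⁻¹ ^ 6) * -(16 / 9 * (9 / 2 - lo) * (hi - 3)) ≤ K * lo) : BandOK lo hi K := by
  obtain ⟨hlo, _, hhi, hK, n2, n0, c1, c2, c3⟩ := h
  intro s hls hsh hJ
  have hs1 : 3 < s := lt_of_le_of_ne (hlo.trans hls) (fun e => hJ (mem_junctions.2 (Or.inr (Or.inl e.symm))))
  have hs2 : s < 9 / 2 := by linarith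
  obtain ⟨⟨L0, U0⟩, ⟨L1, U1⟩, ⟨L2, U2⟩, ⟨P0, Q0⟩, ⟨P1, Q1⟩, ⟨P2, Q2⟩⟩ := window_facts hlo hls hsh (by linarith)
  have hp2 : pW2 s ≤ 0 := by rw [pW2]; linarith
  have t1l := prod_lower_np L2 n2 P0 Q0
  have t1u : ljD2 s * pW s ≤ 0 := mul_nonpos_of_nonpos_of_nonneg U2 P0
  have t2l := prod_lower_pn L1 U1 P1 Q1
  have t2u : ljD1 s * pW1 s ≤ 0 := mul_nonpos_of_nonneg_of_nonpos L1 Q1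
  have t3l : 0 ≤ lennardJones s * pW2 s := mul_nonneg_of_nonpos_of_nonpos U0 hp2
  have t3u := prod_upper_nn L0 n0 P2 hp2
  have w1l : 0 ≤ ljD1 s * pW s := mul_nonneg L1 P0
  have w1u : ljD1 s * pW s ≤ (lo⁻¹ ^ 7 - hi⁻¹ ^ 13) * (16 / 27 * (9 / 2 - lo) ^ 2 * (hi - 9 / 4)) :=
    mul_le_mul U1 Q0 P0 (L1.trans U1)
  have w2l : 0 ≤ lennardJones s * pW1 s := mul_nonneg_of_nonpos_of_nonpos U0 Q1
  have w2u := prod_upper_nn L0 n0 P1 Q1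
  have hKs : K * lo ≤ K * s := mul_le_mul_of_nonneg_left hls hK
  rw [deriv2_Wrec_window hs1 hs2, deriv_Wrec_window hs1.le hs2.le]
  constructor <;> (rw [abs_le]; constructor <;> linarith)

/-- ★ WINDOW-regime band lemma, upper half (`15/4 ≤ lo ≤ s ≤ hi ≤ 9/2`, where `(1 − w₄₅)″ ≥ 0`). -/
theorem window_band_hi {lo hi K : ℝ}
    (h : 15 / 4 ≤ lo ∧ lo ≤ hi ∧ hi ≤ 9 / 2 ∧ 0 ≤ K ∧
      13 * hi⁻¹ ^ 14 - 7 * lo⁻¹ ^ 8 ≤ 0 ∧ 1 / 12 * hi⁻¹ ^ 12 - 1 / 6 * lo⁻¹ ^ 6 ≤ 0 ∧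
      -((13 * hi⁻¹ ^ 14 - 7 * lo⁻¹ ^ 8) * (16 / 27 * (9 / 2 - lo) ^ 2 * (hi - 9 / 4)) +
        2 * ((lo⁻¹ ^ 7 - hi⁻¹ ^ 13) * -(16 / 9 * (9 / 2 - lo) * (hi - 3))) +
        (1 / 12 * hi⁻¹ ^ 12 - 1 / 6 * lo⁻¹ ^ 6) * ((32 * hi - 120) / 9)) ≤ K ∧
      (lo⁻¹ ^ 7 - hi⁻¹ ^ 13) * (16 / 27 * (9 / 2 - lo) ^ 2 * (hi - 9 / 4)) +
        (1 / 12 * hi⁻¹ ^ 12 - 1 / 6 * lo⁻¹ ^ 6) * -(16 / 9 * (9 / 2 - lo) * (hi - 3)) ≤ K * lo) : BandOK lo hi K := by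
  obtain ⟨hlo, _, hhi, hK, n2, n0, c2, c3⟩ := h
  intro s hls hsh hJ
  have hs1 : 3 < s := by linarith
  have hs2 : s < 9 / 2 := lt_of_le_of_ne (hsh.trans hhi) (fun e => hJ (mem_junctions.2 (Or.inr (Or.inr e))))
  obtain ⟨⟨L0, U0⟩, ⟨L1, U1⟩, ⟨L2, U2⟩, ⟨P0, Q0⟩, ⟨P1, Q1⟩, ⟨P2, Q2⟩⟩ := window_facts (by linarith) hls hsh hhi
  have hp2 : 0 ≤ pW2 s := by rw [pW2]; linarith
  have t1l := prod_lower_np L2 n2 P0 Q0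
  have t1u : ljD2 s * pW s ≤ 0 := mul_nonpos_of_nonpos_of_nonneg U2 P0
  have t2l := prod_lower_pn L1 U1 P1 Q1
  have t2u : ljD1 s * pW1 s ≤ 0 := mul_nonpos_of_nonneg_of_nonpos L1 Q1
  have t3l := prod_lower_np L0 n0 hp2 Q2
  have t3u : lennardJones s * pW2 s ≤ 0 := mul_nonpos_of_nonpos_of_nonneg U0 hp2
  have w1l : 0 ≤ ljD1 s * pW s := mul_nonneg L1 P0
  have w1u : ljD1 s * pW s ≤ (lo⁻¹ ^ 7 - hi⁻¹ ^ 13) * (16 / 27 * (9 / 2 - lo) ^ 2 * (hi - 9 / 4)) :=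
    mul_le_mul U1 Q0 P0 (L1.trans U1)
  have w2l : 0 ≤ lennardJones s * pW1 s := mul_nonneg_of_nonpos_of_nonpos U0 Q1
  have w2u := prod_upper_nn L0 n0 P1 Q1
  have hKs : K * lo ≤ K * s := mul_le_mul_of_nonneg_left hls hK
  rw [deriv2_Wrec_window hs1 hs2, deriv_Wrec_window hs1.le hs2.le]
  constructor <;> (rw [abs_le]; constructor <;> linarith)

/-- FAR band lemma (`9/2 ≤ lo`): `W₄₅ ≡ 0` beyond the range. -/
theorem far_band {lo hi K : ℝ} (h : 9 / 2 ≤ lo ∧ 0 ≤ K) : BandOK lo hi K := by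
  intro s hls _ hJ
  have hs : 9 / 2 < s := lt_of_le_of_ne (h.1.trans hls) (fun e => hJ (mem_junctions.2 (Or.inr (Or.inr e.symm))))
  rw [deriv2_Wrec_far hs, deriv_Wrec_far hs.le, abs_zero]
  exact ⟨h.2, mul_nonneg h.2 (by linarith)⟩

end Summit.AtomisticToContinuum.Crystallization.Theorems.FrustratedLawDichotomyStrainedPatchTaylorKbandKit
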